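/- Lead seat `ym-line-cbag-p1` (prover-ym-line-cbag-p1-g18-0) of the sibling line `ColdBoxAllGroups` (planner-of-record ym-idea-2; own crux
`BoxFloorAllGroups` stmt-QuantumFields-22254 CLOSED): torus-side dictionary for route `SixPlaneColdBox` (cruxes `DensityTransferG`
stmt-QuantumFields-25709 / target `BulkDominatesBoxDensityG` stmt-QuantumFields-25707).  RECORD-type material; the Yang–Mills mass gap is NOT
proved by anything here. -/
import Summits.QuantumFields.YangMills.Theorems.WeakCouplingRatesCurrency
import Summits.QuantumFields.YangMills.Theorems.ColdBoxAllGroupsBoxAllPairsCoreG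
import Literature.MathematicalPhysics.QuantumLattice.LatticeGaugeDLRCovarianceSplit
import Literature.MathematicalPhysics.QuantumFieldTheory.ActionDensityTimeReflection
import Literature.Probability.LatticeModels.LoewnerAssociation

/-!
# Route `SixPlaneColdBox`: the torus two-point function of the six-plane density is the sum of the 36 plaquette-pair covariances

The node `LatticeNonFreezing` and the route's target `BulkDominatesBoxDensityG` (stmt-QuantumFields-25707) are phrased with the OS-data
connected correlator `latticeConnectedCorr r.ρ β (2S+1) (actionDensity r.ρ) (actionDensity r.ρ) n` of the SIX-PLANE Wilson action density
`actionDensity ρ = Σ_{μ<ν} Re tr ρ(U_{p_{μν}(0)})`, while the transfer engine of the cruxes (`DensityTransferG`, stmt-QuantumFields-25709: "kernel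
covariance and mean expansions with datum for all 36 plane pairs") works plaquette pair by plaquette pair with the COSTS
`plaqCost0 ρ μ ν = N − Re tr ρ(U_{p_{μν}(0)})`.  This file is the dictionary between the two:

* `latticeConnectedCorr_eq_shifted_mean` — translation invariance of the torus Wilson state lets the second one-point function of
  `latticeConnectedCorr` be read on the time-shifted observable, so that it is a genuine covariance `Cov(A∘lift, B∘θ∘lift)`;
* `cov_const_sub` — `Cov(c − F, c' − G) = Cov(F, G)` under a probability measure (the passage costs ↔ observables, `Re tr = N − cost`);
* `latticeConnectedCorr_actionDensity_eq_sum_pairs` (unitary continuous `ρ`, second-countable `G`) and `…_of_rep` (every faithful unitary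
  lattice representation `r`, the binder shape of the route):
  `latticeConnectedCorr ρ β S (actionDensity ρ) (actionDensity ρ) n = Σ_{q} Σ_{q'} latticeConnectedCorr ρ β S (plaqCost0 ρ q) (plaqCost0 ρ q') n`
  over the ordered planes `q, q' : {μ<ν}` — bilinearity (`ColdBoxAllGroups.cov_sum_sum_eq`) after the two steps above.

Bookkeeping only (bounded measurable observables on a probability space); no expansion, no estimate.  No sorry; standard axioms.
NOT the Yang–Mills mass gap; no summit statement and no item is proved here.
-/

set_option autoImplicit false

noncomputable section

open MeasureTheory Filter Topology
open Literature.MathematicalPhysics.QuantumFieldTheory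
open Literature.MathematicalPhysics.QuantumLattice
open Summit.QuantumFields.YangMills.Theorems.WeakCouplingRates

namespace Summit.QuantumFields.YangMills.Theorems.SixPlaneColdBox

/-! ### A measure-theoretic bookkeeping lemma -/

/-- `Cov(c − F, c' − G) = Cov(F, G)` for integrable `F, G, F·G` under a probability measure. -/
theorem cov_const_sub {Ω : Type*} [MeasurableSpace Ω] (μ : Measure Ω) [IsProbabilityMeasure μ] (F G : Ω → ℝ) (c c' : ℝ)
    (hF : Integrable F μ) (hG : Integrable G μ) (hFG : Integrable (fun ω => F ω * G ω) μ) :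
    (∫ ω, (c - F ω) * (c' - G ω) ∂μ) - (∫ ω, (c - F ω) ∂μ) * (∫ ω, (c' - G ω) ∂μ) =
      (∫ ω, F ω * G ω ∂μ) - (∫ ω, F ω ∂μ) * (∫ ω, G ω ∂μ) := by
  have e1 : ∫ ω, (c - F ω) * (c' - G ω) ∂μ = (c * c' + ∫ ω, F ω * G ω ∂μ) - (c * ∫ ω, G ω ∂μ + c' * ∫ ω, F ω ∂μ) := by
    have h : ∀ ω, (c - F ω) * (c' - G ω) = (c * c' + F ω * G ω) - (c * G ω + c' * F ω) := fun ω => by ring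
    have i1 : Integrable (fun ω => c * c' + F ω * G ω) μ := (integrable_const _).add hFG
    have i2 : Integrable (fun ω => c * G ω + c' * F ω) μ := (hG.const_mul c).add (hF.const_mul c')
    have iG : Integrable (fun ω => c * G ω) μ := hG.const_mul c
    have iF : Integrable (fun ω => c' * F ω) μ := hF.const_mul c'
    simp_rw [h]
    rw [integral_sub i1 i2, integral_add (integrable_const _) hFG, integral_add iG iF, integral_const_mul c G,
      integral_const_mul c' F]
    simp
  have e2 : ∫ ω, (c - F ω) ∂μ = c - ∫ ω, F ω ∂μ := by
    rw [integral_sub (integrable_const c) hF]; simp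
  have e3 : ∫ ω, (c' - G ω) ∂μ = c' - ∫ ω, G ω ∂μ := by
    rw [integral_sub (integrable_const c') hG]; simp
  rw [e1, e2, e3]; ring

/-! ### The torus connected correlator as a genuine covariance -/

section Torus

variable {N : ℕ} {G : Type} [Group G] [TopologicalSpace G] [IsTopologicalGroup G] [CompactSpace G]
  [MeasurableSpace G] [BorelSpace G]

/-- **Shifted second mean.**  By translation invariance of the torus Wilson state (`integral_comp_configShift_torusLift`), the second
one-point function in `latticeConnectedCorr ρ β S A B n` may be read on the time-shifted observable, so that
`latticeConnectedCorr ρ β S A B n = E[(A∘lift)·(B∘θ₋ₙ∘lift)] − E[A∘lift]·E[B∘θ₋ₙ∘lift]` is a genuine covariance. -/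
theorem latticeConnectedCorr_eq_shifted_mean (ρ : G →* Matrix (Fin N) (Fin N) ℂ) (β : ℝ) (S : ℕ) [NeZero S]
    (A B : LGConfig 4 G → ℝ) (n : ℕ) :
    latticeConnectedCorr ρ β S A B n =
      (∫ U, A (torusLift S U) * B (configShift (-Pi.single 0 (n : ℤ)) (torusLift S U)) ∂(wilsonMeasure (d := 4) (L := S) ρ β)) -
        (∫ U, A (torusLift S U) ∂(wilsonMeasure (d := 4) (L := S) ρ β)) *
          ∫ U, B (configShift (-Pi.single 0 (n : ℤ)) (torusLift S U)) ∂(wilsonMeasure (d := 4) (L := S) ρ β) := by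
  rw [integral_comp_configShift_torusLift (S := S) ρ β B (-Pi.single 0 (n : ℤ))]
  rfl

variable [SecondCountableTopology G]

omit [CompactSpace G] in
/-- `plaqCost0 ρ i j` is measurable (continuous `ρ`, second-countable `G`). -/
theorem measurable_plaqCost0 (ρ : G →* Matrix (Fin N) (Fin N) ℂ) (hρ : Continuous ρ) (i j : Fin 4) :
    Measurable (plaqCost0 (d := 4) ρ i j) :=
  (continuous_const.sub (continuous_plaquetteObs ρ hρ 0 i j)).measurable

omit [TopologicalSpace G] [IsTopologicalGroup G] [CompactSpace G] [MeasurableSpace G] [BorelSpace G] [SecondCountableTopology G] in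
/-- `|plaqCost0 ρ i j U| ≤ 2N` for a unitary `ρ` of degree `N`. -/
theorem abs_plaqCost0_le (ρ : G →* Matrix (Fin N) (Fin N) ℂ) (hρu : ∀ g, ρ g ∈ Matrix.unitaryGroup (Fin N) ℂ) (i j : Fin 4)
    (U : LGConfig 4 G) : |plaqCost0 (d := 4) ρ i j U| ≤ 2 * N := by
  have h := abs_plaquetteObs_le_holds (G := G) ρ hρu 0 i j U
  have h1 := abs_sub (N : ℝ) (plaquetteObs ρ 0 i j U)
  rw [Nat.abs_cast] at h1
  simp only [plaqCost0]
  linarith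

/-- **Dictionary: the torus two-point function of the six-plane density is the sum of the 36 plaquette-pair covariances.**  For a
continuous unitary `ρ` (second-countable `G`), every `β`, torus side `S`, separation `n`:
`latticeConnectedCorr ρ β S (actionDensity ρ) (actionDensity ρ) n = Σ_q Σ_{q'} latticeConnectedCorr ρ β S (plaqCost0 ρ q) (plaqCost0 ρ q') n`
over ordered planes `q = (μ<ν)`, `q' = (μ'<ν')` — `actionDensity = Σ_q (N − plaqCost0 q)` (`actionDensity_eq_sum_subtype`), the constants drop
out of covariances (`cov_const_sub`, translation invariance for the second mean), bilinearity (`ColdBoxAllGroups.cov_sum_sum_eq`).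
Bookkeeping for the cruxes `DensityTransferG` / `BulkDominatesBoxDensityG`; NOT the Clay gap. -/
theorem latticeConnectedCorr_actionDensity_eq_sum_pairs (ρ : G →* Matrix (Fin N) (Fin N) ℂ) (hρ : Continuous ρ)
    (hρu : ∀ g, ρ g ∈ Matrix.unitaryGroup (Fin N) ℂ) (β : ℝ) (S : ℕ) [NeZero S] (n : ℕ) :
    latticeConnectedCorr ρ β S (actionDensity ρ) (actionDensity ρ) n =
      ∑ q : {q : Fin 4 × Fin 4 // q.1 < q.2}, ∑ q' : {q : Fin 4 × Fin 4 // q.1 < q.2},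
        latticeConnectedCorr ρ β S (plaqCost0 ρ q.1.1 q.1.2) (plaqCost0 ρ q'.1.1 q'.1.2) n := by
  haveI := isProbabilityMeasure_wilsonMeasure (d := 4) (L := S) ρ hρ β
  -- every connected correlator read with the shifted second mean
  simp only [latticeConnectedCorr_eq_shifted_mean]
  -- the lifted costs, unshifted (`f`) and time-shifted (`g`)
  set v : Literature.Probability.LatticeModels.Site 4 := -Pi.single 0 (n : ℤ) with hv
  set f : {q : Fin 4 × Fin 4 // q.1 < q.2} → _ → ℝ := fun q U => plaqCost0 (d := 4) ρ q.1.1 q.1.2 (torusLift S U) with hf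
  set g : {q : Fin 4 × Fin 4 // q.1 < q.2} → _ → ℝ := fun q U => plaqCost0 (d := 4) ρ q.1.1 q.1.2 (configShift v (torusLift S U))
    with hg
  -- measurability, bounds, integrability
  have hfm : ∀ q, Measurable (f q) := fun q => (measurable_plaqCost0 ρ hρ q.1.1 q.1.2).comp (measurable_torusLift S)
  have hgm : ∀ q, Measurable (g q) := fun q =>
    ((measurable_plaqCost0 ρ hρ q.1.1 q.1.2).comp (configShift v).measurable).comp (measurable_torusLift S)
  have hfb : ∀ q U, |f q U| ≤ 2 * N := fun q U => abs_plaqCost0_le ρ hρu q.1.1 q.1.2 _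
  have hgb : ∀ q U, |g q U| ≤ 2 * N := fun q U => abs_plaqCost0_le ρ hρu q.1.1 q.1.2 _
  have hfi : ∀ q, Integrable (f q) (wilsonMeasure (d := 4) (L := S) ρ β) := fun q =>
    Literature.Probability.LatticeModels.integrable_of_measurable_of_abs_le (hfm q) (hfb q)
  have hgi : ∀ q, Integrable (g q) (wilsonMeasure (d := 4) (L := S) ρ β) := fun q =>
    Literature.Probability.LatticeModels.integrable_of_measurable_of_abs_le (hgm q) (hgb q)
  have hfgi : ∀ q q', Integrable (fun U => f q U * g q' U) (wilsonMeasure (d := 4) (L := S) ρ β) := fun q q' =>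
    Literature.Probability.LatticeModels.integrable_of_measurable_of_abs_le ((hfm q).mul (hgm q')) (C := 2 * N * (2 * N)) fun U => by
      rw [abs_mul]; exact mul_le_mul (hfb q U) (hgb q' U) (abs_nonneg _) (by positivity)
  -- the density is `Σ_q (N − cost_q)`
  have hA : ∀ V : LGConfig 4 G, actionDensity ρ V = ∑ q : {q : Fin 4 × Fin 4 // q.1 < q.2}, ((N : ℝ) - plaqCost0 (d := 4) ρ q.1.1 q.1.2 V) := by
    intro V
    rw [actionDensity_eq_sum_subtype]
    refine Finset.sum_congr rfl fun q _ => ?_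
    simp [plaqCost0]
  have hsumN : ∀ (h : {q : Fin 4 × Fin 4 // q.1 < q.2} → ℝ),
      ∑ q : {q : Fin 4 × Fin 4 // q.1 < q.2}, ((N : ℝ) - h q) = (∑ q : {q : Fin 4 × Fin 4 // q.1 < q.2}, (N : ℝ)) - ∑ q, h q :=
    fun h => Finset.sum_sub_distrib (fun _ => (N : ℝ)) h
  have hF : ∀ U, actionDensity ρ (torusLift S U) = (∑ q : {q : Fin 4 × Fin 4 // q.1 < q.2}, (N : ℝ)) - ∑ q, f q U := fun U => by
    rw [hA, hsumN]
  have hG : ∀ U, actionDensity ρ (configShift v (torusLift S U)) = (∑ q : {q : Fin 4 × Fin 4 // q.1 < q.2}, (N : ℝ)) - ∑ q, g q U :=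
    fun U => by rw [hA, hsumN]
  simp only [hF, hG]
  -- constants drop out; bilinearity
  rw [cov_const_sub _ (fun U => ∑ q, f q U) (fun U => ∑ q, g q U) _ _ (integrable_finsetSum _ fun q _ => hfi q)
    (integrable_finsetSum _ fun q _ => hgi q) ?_]
  · exact ColdBoxAllGroups.cov_sum_sum_eq _ f g hfi hgi hfgi
  · have : (fun U => (∑ q, f q U) * (∑ q, g q U)) = fun U => ∑ q, ∑ q', f q U * g q' U := by
      funext U; rw [Finset.sum_mul_sum]
    rw [this]
    exact integrable_finsetSum _ fun q _ => integrable_finsetSum _ fun q' _ => hfgi q q'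

end Torus

/-! ### The binder shape of the route: every faithful unitary lattice representation -/

/-- **The dictionary for every compact `G` and every faithful unitary lattice representation `r`** (Borel structure `borel G`; second
countability from the closed embedding `r.ρ`): on every torus `2S+1`, every `β`, every separation `n`,
`latticeConnectedCorr r.ρ β (2S+1) (actionDensity r.ρ) (actionDensity r.ρ) n = Σ_q Σ_{q'} latticeConnectedCorr r.ρ β (2S+1) (plaqCost0 r.ρ q) (plaqCost0 r.ρ q') n`.
The left side is the torus quantity of `BulkDominatesBoxDensityG` / `LatticeNonFreezing` (`r.curvature.F = actionDensity r.ρ`); the summands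
are the single-pair currency of `TorusMeanNearColdBoxG` / the `BulkAllGroups` engine.  NOT the Clay gap. -/
theorem latticeConnectedCorr_actionDensity_eq_sum_pairs_of_rep :
    ∀ (G : Type) [Group G] [TopologicalSpace G] [IsTopologicalGroup G] [CompactSpace G],
    letI : MeasurableSpace G := borel G
    haveI : BorelSpace G := ⟨rfl⟩
    ∀ (r : LatticeRep G) (β : ℝ) (S n : ℕ),
      latticeConnectedCorr r.ρ β (2 * S + 1) (actionDensity r.ρ) (actionDensity r.ρ) n =
        ∑ q : {q : Fin 4 × Fin 4 // q.1 < q.2}, ∑ q' : {q : Fin 4 × Fin 4 // q.1 < q.2},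
          latticeConnectedCorr r.ρ β (2 * S + 1) (plaqCost0 r.ρ q.1.1 q.1.2) (plaqCost0 r.ρ q'.1.1 q'.1.2) n := by
  intro G _ _ _ _
  letI : MeasurableSpace G := borel G
  haveI : BorelSpace G := ⟨rfl⟩
  intro r β S n
  haveI : SecondCountableTopology G :=
    (r.continuous.isClosedEmbedding r.injective).isEmbedding.secondCountableTopology
  exact latticeConnectedCorr_actionDensity_eq_sum_pairs r.ρ r.continuous r.mem_unitary β (2 * S + 1) n

end Summit.QuantumFields.YangMills.Theorems.SixPlaneColdBox

end
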